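import Mathlib.Analysis.Matrix.Order
import Literature.NumberTheory.LFunctions.Zhang2022.KnifeEdgeLenBandCrossStat
import Literature.NumberTheory.LFunctions.Zhang2022.KnifeEdgeGramPSD
import Literature.NumberTheory.LFunctions.Zhang2022.KnifeEdgeSlotCalculus

/-!
# Zhang (2022), rung F-S3 (Landau–Siegel programme, §D edge len = E*-len⁺): card `z-degree-toeplitz-band`
# (ls-knife-len-idea-1; v1 `z-degree-toeplitz` superseded) — Z-DEGREE GRADING of the test algebra of (2.16): the Toeplitz law (PROVED), the band of
# recipe-evaluable tables `τ_d`, `|d| ≤ 2`, as NAMED-FORMULA SLOTS (bare `Prop`s), the degree-`≤ 2` graded design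
# and its POSITIVITY ENDGAME (PROVED) — the card's First lemma typed in its own currency

Y. Zhang, *Discrete mean estimates and the Landau–Siegel zero*, arXiv:2211.02515v1 [Zhang2022LandauSiegel] —
an unrefereed manuscript under adjudication. **WHAT THIS IS NOT: not a claim about Theorems 1–2 of
arXiv:2211.02515, about Landau–Siegel zeros, or about Parity. The programme SEARCHES and TYPES; no claim about
Landau–Siegel zeros, Theorems 1–2 of arXiv:2211.02515 or a repaired Margin232 until a kernel theorem says so.
`TauTwoLive` (K1), `ZDegreeDark` (K3), `CrossTable`, `DualCrossTable`, `TauTwoTable`, `GradedCloses` are bare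
`Prop`s — statement SHAPES asserted by no one; every `theorem` is finite-sum algebra or an implication between
them and the skeleton's CLAIMS `Prop22i`, `Lemma23`.**

SOURCE: the card `Summits/Parity/GeneralizedHardyLittlewood/Ideas/z-degree-toeplitz-band.md` (ls-knife-len-idea-1 g2,
commit 7043d9794878; graded new-mechanism / KEEP by ls-knife-crit-1 g2 2026-08-27T00:48Z), its Sketch v2.1
`HOME/knife/len/idea-1/Sketch-z-degree-toeplitz.lean` (sha16 707d31b73ad0689f, farm rc 0) and typing spec
`z-degree-toeplitz-firstlemma.md` with the critic's sharpening (s2) «type the degree-2 vector natively, close through the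
generic-table endgame»; typed by ls-knife-typer-1 (cell landau-siegel §D).

THE CARD'S MECHANISM. Grade test vectors of (2.16) by the power of the root-number factor:
`u = Z(ρ,χψ)^k·F(ψ,ρ)` (Zhang's side 1: `k = 0`, `F = H₁`; side 2: `k = 1`, `F = conj H₂`, (2.32)). Under (A)
`Re ρ = ½`, so `|Z(ρ,χψ)| = 1` and the Gram table `⟨Z^a F, Z^b G⟩_Ξ = Σ Re𝔠*·Z^a F·conj(Z^b G)·Reω` (Zhang's REAL
weights, the polar form of (2.16) = the tree's `discPolar`) depends on `a − b` only: it is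
`τ_{a−b}(F,G) = Σ Re𝔠*·Z^{a−b}·F·conj G·Reω` (`zDegMean`; TOEPLITZ LAW, Part 1, PROVED). The
card's Gauss-count rule makes `|d| ≤ 2` recipe-evaluable (`τ₀` = Zhang's side tables, `τ_{±1}` = his cross table
`Ξ₁₃`, `τ_{±2}` = a NEW three-swap table) and `|d| ≥ 3` dark (`ZDegreeDark`, K3).

* Part 1 — objects (Sketch v2.1 D1 verbatim): `zDegMean` (real weights), `zDegMeanC` (complex weights; equal under
  Lemma 2.3/(2.15): `zDegMeanC_eq_zDegMean`), `gradedGram`, `GradedGramDiag` + `_holds`, `ToeplitzLaw` +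
  `toeplitzLaw_holds` (P1, PROVED: `conj Z = Z⁻¹` on `|Z| = 1`), `flatPoly`, K1 `TauTwoLive`, K3 `ZDegreeDark` (verbatim)
  + `ZDegreeDarkInWall`/`ZDegreeDark.inWall` (author's in-wall correction 2026-08-27). OF RECORD (critic's A0 census 01:11Z
  + author's R1 01:30Z): on `χψ` data graded by `Z(·,χψ)` the `d = ±2` exact diagonal is EMPTY — K1 `TauTwoLive` predicted
  FALSE at recipe level, honest `TauTwoTable` instance `X₂ = 0` (`KnifeEdgeLenZDegreeDark`); live retype K1″ in `KnifeEdgeLenZDegreePsi`.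
* Part 2 — the degree-`≤ 2` GRADED DESIGN `s₀·H_f + s₁·Z·conj Q_{g₁} + s₂·Z²·conj Q_{g₂}` on in-class profiles
  `f, g₁, g₂` (polynomials of length `⌊P⌋+1`), as a `tableComb` of `KnifeEdgeGramPSD`; its discrete mean is the
  Gram form of the amplitudes (`discMean_tableComb`), every Gram entry `discPolar (Z^a F) (Z^b G)` IS `gradedGram a b F G`
  (`discPolar_zTwist`, unconditionally), hence a `τ_{a−b}` table once `|Z| = 1` (Prop 2.2 (i); `discPolar_gradedPiece`).
* Part 3 — the SLOTS (typing-spec items 1–2 in the card's own currency; bare `Prop`s with a NAMED functional, no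
  `∃X` — F-len-7 J2): `CrossTable c' d X` (`τ_d(conj Q_g, H_f) ≈ X(f,g)·𝔞𝔓`: `d = 1` Zhang's `Ξ₁₃` for general
  profiles, `d = 2` the NEW table), `TauTwoTable c' X₂ := CrossTable c' 2 X₂` (item 1), `DualCrossTable c' d Y`
  (entry (2,1): `Σ 𝔠*·Z·conj Q_{g₂}·Q_{g₁}·ω`), the main-term matrix `gradedMainMatrix X₁ Y₁ X₂` of a design
  (diagonal = Zhang's `𝔅 = mainTermForm`, slot `InClassMean` of `KnifeEdgeSlotCalculus`), its quadratic form, and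
  K2's closing alternative `GradedCloses X₁ Y₁ X₂` («the ⟨A⟩-evaluated 3×3 Gram form is not PSD on some design»).
* Part 4 — the MODEL SIDE (Mathlib only; Sketch P2 verbatim, PROVED): `thirdRow_forced` (a PSD `3×3` Hermitian
  matrix with SINGULAR top-left `2×2` block has its third row forced: `M₂₀·M₀₁ = M₂₁·M₀₀` — Carathéodory–Toeplitz,
  singular case, via `x⋆Mx = 0 ⇒ Mx = 0`), `toeplitz3`, `ToeplitzKernelForcesTauTwo` + `toeplitzKernelForcesTauTwo_holds`
  (`0 < t₀ = |t₁|`, `T ⪰ 0 ⇒ t₂ = t₁²/t₀`): the dictionary's «singular in-wall block (B-AH kernel) PREDICTS `τ₂`».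
* COMPANION (theorems only): `KnifeEdgeLenZDegreeEndgame` — the slots compose to the design's asymptotic and the
  POSITIVITY ENDGAME `theorem1_of_gradedCloses : InClassMean c' → CrossTable c' 1 X₁ → DualCrossTable c' 1 Y₁ →
  TauTwoTable c' X₂ → GradedCloses X₁ Y₁ X₂ → Prop22i → Lemma23 c' → Theorem1`, and K2's decision located by Part 4:
  at a kernel pair EITHER the forced identity `X₂·conj X₁ = Y₁·𝔅` holds OR the design closes.

TYPER'S NOTE (what does NOT type as worded in the spec, reported to the ideator): the spec's item 2 asks for the
side-3 class `𝒱₃ = {Z²·conj Q}` «as a LenCardTemplate class» with `CrossMean c' θ X 𝒱₃` / `EStarLenPlusShape c' θ X 𝒱₃`;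
those predicates quantify over PROFILE pairs `(v,v′) : (ℝ → ℂ)²`, pair `profPoly u` with the overhang BLOCK
`blockPoly … v` on `[⌈P⌉, ⌈P^θ⌉)` and hard-wire the overhang diagonal `Repair.topDiagForm θ`; a side-3 vector is a
value table whose diagonal is the in-class side table `𝔅(g₂)` — so the faithful typing is the graded one below, whose
endgame needs no `θ` at all. Item 3 (`SideThreeVisible`, the degree-2 dual as an explicit long block) needs the
card's formula for the dual coefficients `b(n)` before it can be a non-vacuous `Prop` (an `∃ b` over `≫ #idx`
free coefficients is junk, J2) — not typed here.

## References
* Y. Zhang, arXiv:2211.02515v1 (2022), §2 (2.2), (2.15)–(2.20), (2.32), Lemma 2.3, Prop. 2.2 (i); §7 Prop 7.1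
  (7.2); §8 (8.2)–(8.5), Lemma 8.1; §9. [cite: Zhang2022LandauSiegel, §2, §7, §8, §9]
* J. B. Conrey, D. W. Farmer, M. R. Zirnbauer, arXiv:0711.0718, p. 7 (the recipe's root-number step).
-/

noncomputable section

open Complex Real ComplexConjugate Matrix
open scoped ComplexOrder

namespace Literature.NumberTheory.LFunctions.Zhang2022.KnifeEdge

open Repair Skeleton

/-! ### Part 1 — Z-degree means, graded Gram entries, the Toeplitz law (Sketch D1/P1; K1, K3 verbatim) -/

section Objects

variable (c' : ℝ) {D : ℕ} [NeZero D] (χ : DirichletCharacter ℂ D)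

/-- D1 · the Z-degree-`d` discrete mean `τ_d(F,G) = Σ_{(ψ,ρ)∈idx} Re 𝔠*(ρ,ψ)·Z(ρ,ψχ)^d·F(ψ,ρ)·conj G(ψ,ρ)·Re ω(ρ)`
with Zhang's REAL weights `Re 𝔠*`, `Re ω` — the off-diagonal polar form of the quadratic form `discMean` of (2.16)
(`d = 0`, `F = G`: `discMean` itself; `d = 0`: `discPolar`). With real weights the table is Hermitian-symmetric,
`τ_{−d}(G,F) = conj τ_d(F,G)`; in the recipe the `d = −2` entries come from `𝔠*` with all three numerator factors
swapped, the `d = +2` entries from `conj 𝔠*`. Verbatim from the card's Sketch v2.1. [cite: Zhang2022LandauSiegel, §2 (2.16)–(2.17), §8 (8.3)–(8.5)] -/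
def zDegMean (d : ℤ) (F G : Chr D → ℂ → ℂ) : ℂ :=
  ∑ i ∈ idx χ, ((cstar c' D i.1 i.2).re : ℂ) * Zpc χ i.1 i.2 ^ d * (F i.1 i.2 * conj (G i.1 i.2)) *
    ((omegaW D i.2).re : ℂ)

/-- the complex-weight variant `Σ 𝔠*·Z^d·F·conj G·ω` (tree convention of `crossStat` / `Skeleton.xi13`: `d = −1`).
Verbatim from the Sketch v2.1. [cite: Zhang2022LandauSiegel, §8 (8.5)] -/
def zDegMeanC (d : ℤ) (F G : Chr D → ℂ → ℂ) : ℂ :=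
  ∑ i ∈ idx χ, cstar c' D i.1 i.2 * Zpc χ i.1 i.2 ^ d * (F i.1 i.2 * conj (G i.1 i.2)) * omegaW D i.2

/-- With real weights (`Im 𝔠* = 0`: Lemma 2.3; `Im ω(ρ) = 0` on the line: (2.15)) the two conventions agree.
[cite: Zhang2022LandauSiegel, §2 Lemma 2.3, (2.15)] -/
theorem zDegMeanC_eq_zDegMean (hreal : ∀ i ∈ idx χ, (cstar c' D i.1 i.2).im = 0 ∧ (omegaW D i.2).im = 0)
    (d : ℤ) (F G : Chr D → ℂ → ℂ) : zDegMeanC c' χ d F G = zDegMean c' χ d F G := by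
  unfold zDegMeanC zDegMean
  refine Finset.sum_congr rfl fun i hi => ?_
  obtain ⟨hc, hω⟩ := hreal i hi
  rw [show cstar c' D i.1 i.2 = ((cstar c' D i.1 i.2).re : ℂ) from Complex.ext (by simp) (by simp [hc]),
    show omegaW D i.2 = ((omegaW D i.2).re : ℂ) from Complex.ext (by simp) (by simp [hω])]
  simp only [Complex.ofReal_re]

/-- The Gram entry `⟨Z^a F, Z^b G⟩_Ξ = Σ Re 𝔠*·(Z^a F)·conj(Z^b G)·Re ω` of two graded test vectors in the positivity
form (2.16). Verbatim from the Sketch v2.1. [cite: Zhang2022LandauSiegel, §2 (2.16)–(2.17)] -/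
def gradedGram (a b : ℕ) (F G : Chr D → ℂ → ℂ) : ℂ :=
  ∑ i ∈ idx χ, ((cstar c' D i.1 i.2).re : ℂ) * (Zpc χ i.1 i.2 ^ a * F i.1 i.2) *
    conj (Zpc χ i.1 i.2 ^ b * G i.1 i.2) * ((omegaW D i.2).re : ℂ)

/-- Sanity (Sketch v2.1 verbatim): the diagonal `a = b = 0`, `F = G` Gram entry has real part `discMean`.
[cite: Zhang2022LandauSiegel, §2 (2.16)] -/
def GradedGramDiag : Prop :=
  ∀ F : Chr D → ℂ → ℂ, (gradedGram c' χ 0 0 F F).re = discMean c' χ F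

/-- `GradedGramDiag` holds: the graded Gram table IS the polar form of Zhang's discrete mean (2.16) (proof from the
Sketch v2.1). [cite: Zhang2022LandauSiegel, §2 (2.16)] -/
theorem gradedGramDiag_holds : GradedGramDiag c' χ := by
  intro F
  unfold gradedGram discMean
  rw [Complex.re_sum]
  refine Finset.sum_congr rfl fun i _ => ?_
  have h : F i.1 i.2 * conj (F i.1 i.2) = ((Complex.normSq (F i.1 i.2) : ℝ) : ℂ) := Complex.mul_conj _
  simp only [pow_zero, one_mul]
  rw [mul_assoc (((cstar c' D i.1 i.2).re : ℝ) : ℂ) (F i.1 i.2) (conj (F i.1 i.2)), h,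
    ← Complex.normSq_eq_norm_sq]
  norm_cast

/-- `GradedGramDiag` — `_holds` alias of `gradedGramDiag_holds` above under the fact's exact name (appended
2026-08-28, D-0026 bookkeeping: the proof term is the existing theorem of this file; no statement,
definition or attribute is edited; no new named fact; the ledger's debt table listed the fact
unproved). [cite: Zhang2022LandauSiegel, §2 (2.16)] -/
theorem _root_.Literature.NumberTheory.LFunctions.Zhang2022.KnifeEdge.GradedGramDiag_holds :
    GradedGramDiag c' χ :=
  _root_.Literature.NumberTheory.LFunctions.Zhang2022.KnifeEdge.gradedGramDiag_holds (c' := c') (χ := χ)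

/-- P1 · TOEPLITZ LAW: if `|Z(ρ,ψχ)| = 1` at every index point (true under Prop. 2.2 (i): `Re ρ = ½`, (8.2)) the graded
Gram table depends on `a − b` only. Verbatim from the Sketch; PROVED below. [cite: Zhang2022LandauSiegel, §8 (8.2)] -/
def ToeplitzLaw : Prop :=
  (∀ i ∈ idx χ, ‖Zpc χ i.1 i.2‖ = 1) →
    ∀ (a b : ℕ) (F G : Chr D → ℂ → ℂ),
      gradedGram c' χ a b F G = zDegMean c' χ ((a : ℤ) - (b : ℤ)) F G

/-- **P1 PROVED:** the Toeplitz law holds (`conj Z = Z⁻¹` on the unit circle, `Z^a·Z^{−b} = Z^{a−b}`).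
[cite: Zhang2022LandauSiegel, §8 (8.2)] -/
theorem toeplitzLaw_holds : ToeplitzLaw c' χ := by
  intro hZ a b F G
  unfold gradedGram zDegMean
  refine Finset.sum_congr rfl fun i hi => ?_
  have h1 : ‖Zpc χ i.1 i.2‖ = 1 := hZ i hi
  have hne : Zpc χ i.1 i.2 ≠ 0 := by
    intro h0
    rw [h0, norm_zero] at h1
    exact zero_ne_one h1
  rw [map_mul, map_pow, ← Complex.inv_eq_conj h1, zpow_sub₀ hne, zpow_natCast, zpow_natCast, inv_pow]
  field_simp

/-- `ToeplitzLaw` — `_holds` alias of `toeplitzLaw_holds` above under the fact's exact name (appended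
2026-08-28, D-0026 bookkeeping: the proof term is the existing theorem of this file; no statement,
definition or attribute is edited; no new named fact; the ledger's debt table listed the fact
unproved). [cite: Zhang2022LandauSiegel, §8 (8.2)] -/
theorem _root_.Literature.NumberTheory.LFunctions.Zhang2022.KnifeEdge.ToeplitzLaw_holds :
    ToeplitzLaw c' χ :=
  _root_.Literature.NumberTheory.LFunctions.Zhang2022.KnifeEdge.toeplitzLaw_holds (c' := c') (χ := χ)

/-- the flat side-1 profile polynomial of length `N` (profile `g ≡ 1`). Verbatim from the Sketch.
[cite: Zhang2022LandauSiegel, §2 (2.23)] -/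
def flatPoly (N : ℕ) (x : Chr D) (s : ℂ) : ℂ := profPoly χ x (fun _ => (1 : ℂ)) N s

/-- **K1 (crux, rank 2; OPEN — asserted by no one) · `τ₂` IS LIVE AT MAIN ORDER:** the three-swap table between a
side-3 vector `Z²·conj(flat_M)` and a side-1 vector `flat_N`, both of Zhang length `≤ P`, has size `≫ 𝔞𝔓` under (A)
(the recipe main term of the pattern `L(1−s−β₁,ψ̄)L(1−s−β₂,ψ̄)L(1−s−β₃,ψ̄)/L(s,ψ)` does not cancel). A LOWER BOUND with
no free functional (F-len-7 J2). Verbatim from the Sketch. [cite: Zhang2022LandauSiegel, §8 (8.5), Lemma 8.1, §9] -/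
def TauTwoLive : Prop :=
  ∃ c : ℝ, 0 < c ∧ ForAllLarge fun D _ χ => AssumptionA D χ →
    ∃ N M : ℕ, (N : ℝ) ≤ bigP D ∧ (M : ℝ) ≤ bigP D ∧
      c * frakA χ * frakP D ≤
        ‖zDegMean c' χ 2 (fun x s => conj (flatPoly χ M x s)) (fun x s => flatPoly χ N x s)‖

/-- **K3 (support; OPEN — asserted by no one) · Z-DEGREE DARKNESS:** for `|d| ≥ 3` every table between
bounded-coefficient polynomial values of lengths `N·M ≤ (P·D·t₀)²` is `o(𝔞𝔓)` under (A) (net Gauss-sum power `≥ 1`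
in every swap pattern ⇒ hyper-Kloosterman sums, Deligne). Verbatim from the Sketch. AUTHOR'S CAVEAT (ls-knife-len-idea-1
g3 2026-08-27T01:42:50Z; erratum, statement bytes unchanged): Deligne-termwise darkness holds only IN-WALL (all lengths `< p`);
the range `N·M ≤ (PDt₀)²` reaches past the wall (sums of hyper-Kloosterman sums over ranges `≫ p` complete; (A)-world
lattice harmonics supply even charges) — past-wall part CONJECTURAL with this why-might-fail; in-wall form =
`ZDegreeDarkInWall`. Not load-bearing (exhaustion half only). [cite: Zhang2022LandauSiegel, §8 (8.5), Lemma 8.1] -/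
def ZDegreeDark : Prop :=
  ∀ d : ℤ, 3 ≤ |d| → ∀ ε : ℝ, 0 < ε → ForAllLarge fun D _ χ => AssumptionA D χ →
    ∀ g : ℝ → ℂ, (∀ z, ‖g z‖ ≤ 1) → Measurable g →
    ∀ q : ℕ → ℂ, (∀ m, ‖q m‖ ≤ 1) →
    ∀ N M : ℕ, (N : ℝ) * M ≤ (bigP D * D * t0 D) ^ 2 →
      ‖zDegMean c' χ d (fun x s => profPoly χ x g N s) (fun x s => shortPoly χ x q M s)‖
        ≤ ε * frakA χ * frakP D

/-- **K3 IN-WALL (support; OPEN — asserted by no one):** `ZDegreeDark` restricted to in-wall lengths `N·M ≤ P` (every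
variable below the modulus `p ∼ P`: Gauss-charged patterns are termwise hyper-Kloosterman sums, Deligne term by term) —
the author's corrected range (2026-08-27T01:42:50Z; slogan «band half-width 2 at lattice-harmonic 0»). [cite: Zhang2022LandauSiegel, §8 (8.5), Lemma 8.1] -/
def ZDegreeDarkInWall : Prop :=
  ∀ d : ℤ, 3 ≤ |d| → ∀ ε : ℝ, 0 < ε → ForAllLarge fun D _ χ => AssumptionA D χ →
    ∀ g : ℝ → ℂ, (∀ z, ‖g z‖ ≤ 1) → Measurable g →
    ∀ q : ℕ → ℂ, (∀ m, ‖q m‖ ≤ 1) →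
    ∀ N M : ℕ, (N : ℝ) * M ≤ bigP D →
      ‖zDegMean c' χ d (fun x s => profPoly χ x g N s) (fun x s => shortPoly χ x q M s)‖
        ≤ ε * frakA χ * frakP D

variable {c'} in
/-- The typed K3 implies its in-wall restriction whenever `P ≤ (P·D·t₀)²` eventually. [cite: Zhang2022LandauSiegel, §8 (8.5)] -/
theorem ZDegreeDark.inWall (h : ZDegreeDark c') (hP : ForAllLarge fun D _ _ => bigP D ≤ (bigP D * D * t0 D) ^ 2) :
    ZDegreeDarkInWall c' := fun d hd ε hε =>
  ((h d hd ε hε).and hP).mono fun _ _ _ _ _ hh hA g hg hgm q hq N M hNM => hh.1 hA g hg hgm q hq N M (hNM.trans hh.2)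

end Objects

/-! ### Part 2 — graded pieces `Z^k·F`, the degree-`≤ 2` design, and its Gram entries as `τ_d` tables -/

section Graded

variable {c' : ℝ} {D : ℕ} [NeZero D] (χ : DirichletCharacter ℂ D)

/-- The graded test vector of degree `k` on the value table `F`: `Z(ρ,χψ)^k·F(ψ,ρ)`. [cite: Zhang2022LandauSiegel, §2 (2.32)] -/
def zTwist (k : ℕ) (F : Chr D → ℂ → ℂ) : Chr D → ℂ → ℂ := fun x t => Zpc χ x t ^ k * F x t

/-- The three BASE tables of the card's design on in-class profiles `f, g₁, g₂` (polynomials of length `⌊P⌋+1`):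
`H_f` (side 1), `conj Q_{g₁}` (side 2, Zhang's (2.32) shape), `conj Q_{g₂}` (side 3, NEW). [cite: Zhang2022LandauSiegel, §2 (2.23), (2.32)] -/
def basePiece (f g₁ g₂ : ℝ → ℂ) : Fin 3 → (Chr D → ℂ → ℂ) :=
  ![fun x t => profPoly χ x f (⌊bigP D⌋₊ + 1) t,
    fun x t => conj (profPoly χ x g₁ (⌊bigP D⌋₊ + 1) t),
    fun x t => conj (profPoly χ x g₂ (⌊bigP D⌋₊ + 1) t)]

/-- The graded pieces `u_k = Z^k·(base k)`: `u₀ = H_f`, `u₁ = Z·conj Q_{g₁}`, `u₂ = Z²·conj Q_{g₂}`. [cite: Zhang2022LandauSiegel, §2 (2.32)] -/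
def zGradedPiece (f g₁ g₂ : ℝ → ℂ) (k : Fin 3) : Chr D → ℂ → ℂ := zTwist χ k (basePiece χ f g₁ g₂ k)

/-- **The card's degree-`≤ 2` graded design** with amplitudes `s`: `Σ_k s_k·Z^k·(base k)` — Zhang's (2.32) is the
degree-`≤ 1` case `s = (1, 1, 0)` with his `H₁`, `H₂`. [cite: Zhang2022LandauSiegel, §2 (2.32)] -/
def zGradedDesign (f g₁ g₂ : ℝ → ℂ) (s : Fin 3 → ℂ) : Chr D → ℂ → ℂ := tableComb s (zGradedPiece χ f g₁ g₂)

variable {χ}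

/-- The design's discrete mean is the Gram form of its amplitudes (finite sesquilinearity, `discMean_tableComb`).
[cite: Zhang2022LandauSiegel, §2 (2.16)–(2.17)] -/
theorem discMean_gradedDesign (f g₁ g₂ : ℝ → ℂ) (s : Fin 3 → ℂ) :
    ((discMean c' χ (zGradedDesign χ f g₁ g₂ s) : ℝ) : ℂ) =
      ∑ a, ∑ b, s a * conj (s b) * discPolar c' χ (zGradedPiece χ f g₁ g₂ a) (zGradedPiece χ f g₁ g₂ b) :=
  discMean_tableComb s _

/-- With `|Z| = 1` on the index set a graded vector has the discrete mean of its base table.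
[cite: Zhang2022LandauSiegel, §8 (8.2)] -/
theorem discMean_zTwist (hZ : ∀ i ∈ idx χ, ‖Zpc χ i.1 i.2‖ = 1) (k : ℕ) (F : Chr D → ℂ → ℂ) :
    discMean c' χ (zTwist χ k F) = discMean c' χ F := by
  unfold discMean zTwist
  refine Finset.sum_congr rfl fun i hi => ?_
  rw [norm_mul, norm_pow, hZ i hi, one_pow, one_mul]

omit [NeZero D] in
/-- Conjugating a table does not change its discrete mean. [cite: Zhang2022LandauSiegel, §2 (2.16)] -/
theorem discMean_conj (F : Chr D → ℂ → ℂ) :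
    discMean c' χ (fun x t => conj (F x t)) = discMean c' χ F := by
  unfold discMean
  refine Finset.sum_congr rfl fun i _ => ?_
  rw [Complex.norm_conj]

/-- The tree's real-weight polar pairing of two graded vectors IS the card's graded Gram entry (same weights
`Re 𝔠*·Re ω`). [cite: Zhang2022LandauSiegel, §2 (2.16)–(2.17)] -/
theorem discPolar_zTwist (a b : ℕ) (F G : Chr D → ℂ → ℂ) :
    discPolar c' χ (zTwist χ a F) (zTwist χ b G) = gradedGram c' χ a b F G := by
  unfold discPolar gradedGram zTwist
  refine Finset.sum_congr rfl fun i _ => ?_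
  push_cast
  ring

/-- **Every Gram entry of the graded design is a `τ_d` table** (`d = a − b`) once `|Z| = 1` on the index set.
[cite: Zhang2022LandauSiegel, §2 (2.17), §8 (8.2)] -/
theorem discPolar_gradedPiece (hZ : ∀ i ∈ idx χ, ‖Zpc χ i.1 i.2‖ = 1) (f g₁ g₂ : ℝ → ℂ) (a b : Fin 3) :
    discPolar c' χ (zGradedPiece χ f g₁ g₂ a) (zGradedPiece χ f g₁ g₂ b) =
      zDegMean c' χ ((a : ℕ) - (b : ℕ) : ℤ) (basePiece χ f g₁ g₂ a) (basePiece χ f g₁ g₂ b) := by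
  unfold zGradedPiece
  rw [discPolar_zTwist, toeplitzLaw_holds c' χ hZ]

end Graded

/-! ### Part 3 — the SLOTS of the Toeplitz band (bare `Prop`s, named functionals) and K2's closing alternative -/

section Slots

variable (c' : ℝ)

/-- **CROSS TABLE OF DEGREE `d` (slot shape, OPEN — asserted by no one):** under (A), eventually in `D`, for in-class
profiles `f` (side 1) and `g` (dual side), `τ_d(conj Q_g, H_f) = Σ 𝔠*·Z^d·conj Q_g·conj H_f·ω = X(f,g)·𝔞𝔓 + o(𝔞𝔓)`
with a NAMED functional `X`. `d = 1`: the conjugate of Zhang's cross table `Ξ₁₃` (8.5) for general profiles (his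
§9 evaluates the instance `H₁, H₂`); `d = 2`: the card's NEW three-swap table `τ₂` (K1 is to SUPPLY its `X₂`).
[cite: Zhang2022LandauSiegel, §8 (8.5), Lemma 8.1, §9] -/
def CrossTable (d : ℕ) (X : PairFunctional) : Prop :=
  ∀ (f f' g g' : ℝ → ℂ), InClassPiece f f' → InClassPiece g g' → ∀ ε : ℝ, 0 < ε →
    ForAllLarge fun D _ χ => AssumptionA D χ →
      ‖zDegMean c' χ d (fun x t => conj (profPoly χ x g (⌊bigP D⌋₊ + 1) t))
            (fun x t => profPoly χ x f (⌊bigP D⌋₊ + 1) t)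
          - X f f' g g' * frakA χ * frakP D‖ ≤ ε * frakA χ * frakP D

/-- **Typing-spec item 1 · `TauTwoTable X₂` (slot shape, OPEN):** «under (A), for side-1 data `F = H_f`, `G = H_g` of
Zhang length, `zDegMean c' χ 2 (conj∘G) F = X₂(F,G)·𝔞𝔓 + o(𝔞𝔓)`» — the named-formula slot for the NEW table; `X₂` is
to be supplied by K1, never existentially quantified. [cite: Zhang2022LandauSiegel, §8 (8.5), Lemma 8.1] -/
abbrev TauTwoTable (X₂ : PairFunctional) : Prop := CrossTable c' 2 X₂

/-- **DUAL CROSS TABLE OF DEGREE `d` (slot shape, OPEN):** the Gram entry between two dual-side pieces,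
`Σ 𝔠*·Z^d·conj Q_{g₂}·Q_{g₁}·ω = Y(g₁,g₂)·𝔞𝔓 + o(𝔞𝔓)` (`d = 1`: the entry `⟨Z²conj Q_{g₂}, Z conj Q_{g₁}⟩` of the
design's Gram matrix; Gauss budget of `τ_{±1}`). [cite: Zhang2022LandauSiegel, §2 (2.17), §8 (8.5)] -/
def DualCrossTable (d : ℕ) (Y : PairFunctional) : Prop :=
  ∀ (g₁ g₁' g₂ g₂' : ℝ → ℂ), InClassPiece g₁ g₁' → InClassPiece g₂ g₂' → ∀ ε : ℝ, 0 < ε →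
    ForAllLarge fun D _ χ => AssumptionA D χ →
      ‖zDegMean c' χ d (fun x t => conj (profPoly χ x g₂ (⌊bigP D⌋₊ + 1) t))
            (fun x t => conj (profPoly χ x g₁ (⌊bigP D⌋₊ + 1) t))
          - Y g₁ g₁' g₂ g₂' * frakA χ * frakP D‖ ≤ ε * frakA χ * frakP D

variable {c'}

/-- **The ⟨A⟩-main-term matrix of the graded design** (entry `(a,b)` ↔ `⟨u_a,u_b⟩/(𝔞𝔓)`): diagonal = Zhang's side
tables `𝔅(f), 𝔅(g₁), 𝔅(g₂)` (`mainTermForm`, slot `InClassMean`); `(1,0) = X₁(f,g₁)` (`Ξ₁₃`-table); `(2,1) =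
Y₁(g₁,g₂)`; `(2,0) = X₂(f,g₂)` (the NEW table); upper triangle by Hermitian symmetry. The card's «3×3 block-Toeplitz
form `[[τ₀,τ₁*,τ₂*],[τ₁,τ₀,τ₁*],[τ₂,τ₁,τ₀]]`». [cite: Zhang2022LandauSiegel, §2 (2.16)–(2.17), §7 Prop 7.1, §8 (8.3)–(8.5)] -/
def gradedMainMatrix (X₁ Y₁ X₂ : PairFunctional) (f f' g₁ g₁' g₂ g₂' : ℝ → ℂ) : Matrix (Fin 3) (Fin 3) ℂ :=
  !![(mainTermForm f f' : ℂ), conj (X₁ f f' g₁ g₁'), conj (X₂ f f' g₂ g₂');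
     X₁ f f' g₁ g₁', (mainTermForm g₁ g₁' : ℂ), conj (Y₁ g₁ g₁' g₂ g₂');
     X₂ f f' g₂ g₂', Y₁ g₁ g₁' g₂ g₂', (mainTermForm g₂ g₂' : ℂ)]

/-- The real quadratic form `Re Σ_{a,b} s_a·conj(s_b)·M_{ab}` of a `3×3` table of constants — the would-be constant of
`Ξ(design)/(𝔞𝔓)`. [cite: Zhang2022LandauSiegel, §2 (2.16)–(2.17)] -/
def gradedQuadForm (M : Matrix (Fin 3) (Fin 3) ℂ) (s : Fin 3 → ℂ) : ℝ := (∑ a, ∑ b, s a * conj (s b) * M a b).re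

/-- **K2, closing alternative (shape, OPEN — asserted by no one): the ⟨A⟩-evaluated graded Gram form is NOT positive
semidefinite on some design** — in-class profiles `f, g₁, g₂` and amplitudes `s` with negative main constant. (The
other alternative, the forced-extension identity, and the Carathéodory lemma locating the test are in
`KnifeEdgeLenZDegreeForcing`.) [cite: Zhang2022LandauSiegel, §2 (2.16), §7 Prop 7.1 (7.2)] -/
def GradedCloses (X₁ Y₁ X₂ : PairFunctional) : Prop :=
  ∃ (f f' g₁ g₁' g₂ g₂' : ℝ → ℂ) (s : Fin 3 → ℂ), InClassPiece f f' ∧ InClassPiece g₁ g₁' ∧ InClassPiece g₂ g₂' ∧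
    gradedQuadForm (gradedMainMatrix X₁ Y₁ X₂ f f' g₁ g₁' g₂ g₂') s < 0

end Slots

/-! ### Part 4 — the MODEL SIDE (Mathlib only): Carathéodory–Toeplitz forcing in the singular case (Sketch P2, PROVED) -/

end Literature.NumberTheory.LFunctions.Zhang2022.KnifeEdge

namespace KnifeEdgeLenZDegree

/-- **Singular principal block forces the third row (proved).** For a positive semidefinite `3×3` complex matrix whose
top-left `2×2` block is singular (`M₀₀M₁₁ = M₀₁M₁₀`), `M₂₀·M₀₁ = M₂₁·M₀₀`: the kernel vector `(−M₀₁, M₀₀, 0)` of the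
block has `x⋆Mx = 0`, hence `Mx = 0` (`Matrix.PosSemidef.dotProduct_mulVec_zero_iff`), and its third coordinate is
the identity. The engine the card transplants (Carathéodory–Toeplitz / Dym–Gohberg band extension, singular case:
the extension is UNIQUE). [cite: Zhang2022LandauSiegel, §2 (2.16)] -/
theorem thirdRow_forced {M : Matrix (Fin 3) (Fin 3) ℂ} (hM : M.PosSemidef)
    (hsing : M 0 0 * M 1 1 = M 0 1 * M 1 0) : M 2 0 * M 0 1 = M 2 1 * M 0 0 := by
  set v : Fin 3 → ℂ := ![-(M 0 1), M 0 0, 0] with hv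
  have hMv0 : (M *ᵥ v) 0 = 0 := by
    simp [hv, Matrix.mulVec, dotProduct, Fin.sum_univ_three]; ring
  have hMv1 : (M *ᵥ v) 1 = 0 := by
    simp [hv, Matrix.mulVec, dotProduct, Fin.sum_univ_three]
    linear_combination hsing
  have hq : star v ⬝ᵥ (M *ᵥ v) = 0 := by
    rw [dotProduct, Fin.sum_univ_three, hMv0, hMv1]
    simp [hv]
  have hker : M *ᵥ v = 0 := (hM.dotProduct_mulVec_zero_iff v).mp hq
  have h2 : (M *ᵥ v) 2 = 0 := by rw [hker]; rfl
  simp [hv, Matrix.mulVec, dotProduct, Fin.sum_univ_three] at h2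
  linear_combination (-1 : ℂ) * h2

/-- the Hermitian Toeplitz matrix `[[t0, t1⁻, t2⁻],[t1, t0, t1⁻],[t2, t1, t0]]` of three Z-degree moments. Verbatim
from the Sketch. [cite: Zhang2022LandauSiegel, §2 (2.16)] -/
def toeplitz3 (t0 : ℝ) (t1 t2 : ℂ) : Matrix (Fin 3) (Fin 3) ℂ :=
  !![(t0 : ℂ), starRingEnd ℂ t1, starRingEnd ℂ t2;
     t1, (t0 : ℂ), starRingEnd ℂ t1;
     t2, t1, (t0 : ℂ)]

/-- **P2 · KERNEL FORCES THE NEXT MOMENT** (Carathéodory–Toeplitz, singular case): if the `2×2` Toeplitz block is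
singular (`|t1| = t0 > 0`) then positivity of the `3×3` extension pins `t2 = t1²/t0`. Dictionary: `t0 ↦ τ₀` (Zhang's
side tables), `t1 ↦ τ₁` (`Ξ₁₃`), singular ↦ the B-AH kernel (AFE modes `P_j + Z·conj Q_j`), `t2 ↦ τ₂`. Verbatim from
the Sketch; PROVED below. [cite: Zhang2022LandauSiegel, §2 (2.16), (2.32)] -/
def ToeplitzKernelForcesTauTwo : Prop :=
  ∀ (t0 : ℝ) (t1 t2 : ℂ), 0 < t0 → ‖t1‖ = t0 →
    (toeplitz3 t0 t1 t2).PosSemidef → t2 = t1 ^ 2 / t0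

/-- **P2 PROVED** (from `thirdRow_forced`: `t2·conj t1 = t1·t0` and `conj t1·t1 = t0²`). [cite: Zhang2022LandauSiegel, §2 (2.16)] -/
theorem toeplitzKernelForcesTauTwo_holds : ToeplitzKernelForcesTauTwo := by
  intro t0 t1 t2 ht0 ht1 hM
  have hcc : conj t1 * t1 = ((t0 ^ 2 : ℝ) : ℂ) := by
    rw [Complex.conj_mul' t1, ht1]; push_cast; ring
  have hsing : toeplitz3 t0 t1 t2 0 0 * toeplitz3 t0 t1 t2 1 1 =
      toeplitz3 t0 t1 t2 0 1 * toeplitz3 t0 t1 t2 1 0 := by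
    simp [toeplitz3]
    rw [hcc]; push_cast; ring
  have h := thirdRow_forced hM hsing
  simp [toeplitz3] at h
  have ht0ne : (t0 : ℂ) ≠ 0 := by exact_mod_cast ht0.ne'
  have key : t2 * ((t0 ^ 2 : ℝ) : ℂ) = t1 ^ 2 * t0 := by
    rw [← hcc, ← mul_assoc, h]; ring
  push_cast at key
  have key' : t2 * (t0 : ℂ) = t1 ^ 2 := by
    apply mul_right_cancel₀ ht0ne
    linear_combination key
  rw [eq_div_iff ht0ne]
  exact key'

end KnifeEdgeLenZDegree

end
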